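import Mathlib
import HarnessLib

/-!
# (iso-succ) PART A′ — the graded lemma with EQUAL TOP WEIGHTS: `G ^ ν ∣ F`, `F` weighted-homogeneous of degree `w i · ν` with a monomial of
# standard degree `ν`, `G` weighted-homogeneous of positive degree ⇒ `F = c · G ^ ν`, `G = ℓ + φ` with `ℓ ≠ 0` LINEAR
# (door `HypersurfaceCentreConstruction`, stmt-ResolutionOfSingularities-19897; P3 rung `stub_keyRungLE_three`, skeleton v3.8; ORDER (o42),
# RULING gen 11 #6 (2) of res-L1-w43-plan-1: PART A′ → res-type-061, pair of res-type-073's PART C; the `r₁ = r₂` reading of PART A p533815)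

Topic: `Summits/ResolutionOfSingularities/ResolutionOfSingularities/Theorems`.  DEF-FREE, Mathlib-only.  PART A (`Iota3.eq_C_mul_pow_of_pow_dvd`,
p533815) needs the pure power `X i ^ ν` to occur in `F` — automatic when `w i` is the STRICTLY largest weight ((BR3),
`Iota3.coeff_single_faceSum_ne_zero`, p536107), false in general when the top weight is attained twice (`r₁ = r₂`: the degree-`ν` part of
`in_w f` is a binary form).  PART A′ replaces that hypothesis by «`F` has SOME monomial of standard degree `ν`» ((BR3)
`Iota3.exists_coeff_faceSum_ne_zero_of_degree_eq`) and argues with LOWEST standard-degree forms instead of the `X i`-degree: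

* bottom components multiply in a domain: `weightedHomogeneousComponent_mul_of_le_weight` / `_pow_of_le_weight` (for ANY weight `w`; used
  with `w = 1`, i.e. standard degree) and the support bounds `le_weight_of_mem_support_mul/_pow`;
* **`Iota3.eq_C_mul_pow_of_pow_dvd_of_le`** — `k` a field, positive weights with `w j ≤ w i` for all `j`, `0 < ν`, `F` weighted-homogeneous of
  degree `w i · ν` with a monomial of standard degree `ν`, `G` weighted-homogeneous of positive degree `d`, `G ^ ν ∣ F` ⇒
  `F = C c * G ^ ν` (`c ≠ 0`), `d = w i`, `G = ℓ + φ` with `ℓ ≠ 0` homogeneous of standard degree `1` (a linear form, supported on variables of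
  weight `w i`) and every monomial of `φ` of standard degree `≥ 2`, both weighted-homogeneous of degree `w i`;
* `Iota3.eq_C_mul_pow_of_pow_dvd_of_le_fin3` — res-type-073's instance `w = ![q, r₂, r₁]`, `0 < q ≤ r₂ ≤ r₁`, `i = 2`.

Proof: in the domain `k[X]` the lowest standard-degree forms multiply, so from `F = G ^ ν · H`: `ν · ord G + ord H = ν` (all monomials of `F`
have degree `≥ ν` because `w j ≤ w i`, and one has degree `ν`); `ord G = 0` would put a constant term in `G` (degree `d = 0`, excluded), so
`ord G = 1`, `ord H = 0`; then `H = C h₀ + H′` with `H′` of positive weight, and comparing weighted components of `F = h₀ G^ν + G^ν H′` gives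
`ν d = w i ν` and `G^ν H′ = 0`.

[folklore commutative algebra; OUR bookkeeping for OUR (o42) lemma; nothing here is a statement about Hironaka's problem or of the manuscript under
review (Hironaka 2017, [claim: Hironaka2017, status: under-review]); AI formalisation, weaker than expert review.]
-/

open MvPolynomial

set_option linter.dupNamespace false -- mandated namespace of this single-conjunct summit

namespace Summit.ResolutionOfSingularities.ResolutionOfSingularities.Cruxes.HypersurfaceCentreConstruction.LocalEngine

namespace Iota3

/-! ## Support bounds and bottom components (any weight) -/

section Bottom

variable {R : Type} [CommRing R] {σ : Type}

/-- Lower weight bounds add under multiplication. [folklore] -/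
theorem le_weight_of_mem_support_mul (w : σ → ℕ) {P Q : MvPolynomial σ R} {a b : ℕ}
    (hP : ∀ m ∈ P.support, a ≤ Finsupp.weight w m) (hQ : ∀ m ∈ Q.support, b ≤ Finsupp.weight w m) :
    ∀ m ∈ (P * Q).support, a + b ≤ Finsupp.weight w m := by
  classical
  intro m hm
  obtain ⟨p, hp, q, hq, rfl⟩ := Finset.mem_add.mp (support_mul P Q hm)
  rw [map_add]
  exact add_le_add (hP p hp) (hQ q hq)

/-- Lower weight bounds scale under powers. [folklore] -/
theorem le_weight_of_mem_support_pow (w : σ → ℕ) {P : MvPolynomial σ R} {a : ℕ} (hP : ∀ m ∈ P.support, a ≤ Finsupp.weight w m)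
    (n : ℕ) : ∀ m ∈ (P ^ n).support, n * a ≤ Finsupp.weight w m := by
  induction n with
  | zero => intro m _; rw [zero_mul]; exact Nat.zero_le _
  | succ n ih =>
    intro m hm
    rw [pow_succ] at hm
    rw [Nat.succ_mul]
    exact le_weight_of_mem_support_mul w ih hP m hm

/-- A weighted-homogeneous polynomial all of whose monomials have weight above its degree is zero. [folklore] -/
theorem eq_zero_of_isWeightedHomogeneous_of_lt (w : σ → ℕ) {P : MvPolynomial σ R} {n : ℕ} (h : P.IsWeightedHomogeneous w n)
    (h' : ∀ m ∈ P.support, n < Finsupp.weight w m) : P = 0 := by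
  ext m
  rw [coeff_zero]
  by_contra hm
  exact (h' m (mem_support_iff.mpr hm)).ne (h hm).symm

/-- **Bottom components multiply**: if every monomial of `P` has weight `≥ a` and every monomial of `Q` has weight `≥ b`, the weight-`(a + b)`
component of `P · Q` is the product of the weight-`a` component of `P` and the weight-`b` component of `Q`. [folklore] -/
theorem weightedHomogeneousComponent_mul_of_le_weight (w : σ → ℕ) {P Q : MvPolynomial σ R} {a b : ℕ}
    (hP : ∀ m ∈ P.support, a ≤ Finsupp.weight w m) (hQ : ∀ m ∈ Q.support, b ≤ Finsupp.weight w m) :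
    weightedHomogeneousComponent w (a + b) (P * Q) = weightedHomogeneousComponent w a P * weightedHomogeneousComponent w b Q := by
  classical
  ext m
  by_cases hm : Finsupp.weight w m = a + b
  · rw [coeff_weightedHomogeneousComponent, if_pos hm, coeff_mul, coeff_mul]
    refine Finset.sum_congr rfl fun x hx => ?_
    rw [coeff_weightedHomogeneousComponent, coeff_weightedHomogeneousComponent]
    have hx' : Finsupp.weight w x.1 + Finsupp.weight w x.2 = a + b := by
      rw [← map_add, Finset.HasAntidiagonal.mem_antidiagonal.mp hx, hm]
    by_cases h1 : Finsupp.weight w x.1 = a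
    · have h2 : Finsupp.weight w x.2 = b := by omega
      rw [if_pos h1, if_pos h2]
    · rw [if_neg h1, zero_mul]
      by_cases hP0 : coeff x.1 P = 0
      · rw [hP0, zero_mul]
      · by_cases hQ0 : coeff x.2 Q = 0
        · rw [hQ0, mul_zero]
        · exfalso
          have ha : a ≤ Finsupp.weight w x.1 := hP x.1 (mem_support_iff.mpr hP0)
          have hb : b ≤ Finsupp.weight w x.2 := hQ x.2 (mem_support_iff.mpr hQ0)
          omega
  · rw [coeff_weightedHomogeneousComponent, if_neg hm]
    symm
    exact ((weightedHomogeneousComponent_isWeightedHomogeneous (w := w) a P).mul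
      (weightedHomogeneousComponent_isWeightedHomogeneous (w := w) b Q)).coeff_eq_zero m hm

/-- **Bottom components of powers**: the weight-`n·a` component of `P ^ n` is the `n`-th power of the weight-`a` component of `P` when every
monomial of `P` has weight `≥ a`. [folklore] -/
theorem weightedHomogeneousComponent_pow_of_le_weight (w : σ → ℕ) {P : MvPolynomial σ R} {a : ℕ}
    (hP : ∀ m ∈ P.support, a ≤ Finsupp.weight w m) (n : ℕ) :
    weightedHomogeneousComponent w (n * a) (P ^ n) = weightedHomogeneousComponent w a P ^ n := by
  induction n with
  | zero =>
    rw [zero_mul, pow_zero, pow_zero]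
    exact (isWeightedHomogeneous_one R w).weightedHomogeneousComponent_same
  | succ n ih =>
    rw [pow_succ, pow_succ, Nat.succ_mul, weightedHomogeneousComponent_mul_of_le_weight w (le_weight_of_mem_support_pow w hP n) hP, ih]

/-- A non-zero component exhibits a monomial of that weight. [folklore] -/
theorem exists_mem_support_of_weightedHomogeneousComponent_ne_zero (w : σ → ℕ) {P : MvPolynomial σ R} {n : ℕ}
    (h : weightedHomogeneousComponent w n P ≠ 0) : ∃ m ∈ P.support, Finsupp.weight w m = n := by
  classical
  obtain ⟨m, hm⟩ := ne_zero_iff.mp h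
  rw [coeff_weightedHomogeneousComponent] at hm
  by_cases hw : Finsupp.weight w m = n
  · rw [if_pos hw] at hm
    exact ⟨m, mem_support_iff.mpr hm, hw⟩
  · exact absurd (if_neg hw) hm

/-- The component at the weight of a monomial of `P` is non-zero. [folklore] -/
theorem weightedHomogeneousComponent_ne_zero_of_mem_support (w : σ → ℕ) {P : MvPolynomial σ R} {m : σ →₀ ℕ} (hm : m ∈ P.support) :
    weightedHomogeneousComponent w (Finsupp.weight w m) P ≠ 0 := by
  classical
  intro h
  have hc := congrArg (coeff m) h
  rw [coeff_weightedHomogeneousComponent, if_pos rfl, coeff_zero] at hc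
  exact mem_support_iff.mp hm hc

/-- With positive weights a non-zero exponent has positive weight. [folklore] -/
theorem weight_pos_of_ne_zero (w : σ → ℕ) (hw : ∀ j, 0 < w j) {m : σ →₀ ℕ} (hm : m ≠ 0) : 0 < Finsupp.weight w m := by
  obtain ⟨j, hj⟩ := Finsupp.ne_iff.mp hm
  exact lt_of_lt_of_le (hw j) (Finsupp.le_weight_of_ne_zero' (w := w) hj)

/-- `weight w m ≤ w i · degree m` when `w i` is a top weight. [folklore] -/
theorem weight_le_mul_degree (w : σ → ℕ) (i : σ) (hwi : ∀ j, w j ≤ w i) (m : σ →₀ ℕ) :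
    Finsupp.weight w m ≤ w i * Finsupp.degree m := by
  classical
  rw [Finsupp.weight_apply, Finsupp.degree, Finsupp.sum]
  show ∑ j ∈ m.support, m j • w j ≤ w i * ∑ j ∈ m.support, m j
  rw [Finset.mul_sum]
  exact Finset.sum_le_sum fun j _ => by rw [smul_eq_mul, mul_comm]; exact Nat.mul_le_mul_right _ (hwi j)

end Bottom

/-! ## PART A′ -/

section PartAPrime

variable {k : Type} [Field k] {σ : Type}

/-- **(iso-succ) PART A′ — equal top weights.**  `k` a field, `w : σ → ℕ` positive weights with `w j ≤ w i` for all `j`, `0 < ν`; `F`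
weighted-homogeneous of degree `w i · ν` with SOME monomial of standard degree `ν`; `G` weighted-homogeneous of positive degree `d` with
`G ^ ν ∣ F`.  Then `F = C c * G ^ ν` with `c ≠ 0`, `d = w i`, and `G = ℓ + φ` where `ℓ ≠ 0` is homogeneous of standard degree `1` (a linear form —
necessarily in the variables of weight `w i`: `ℓ.coeff (single j 1) ≠ 0 → w j = w i`), every monomial of `φ` has standard degree `≥ 2`, and `ℓ`,
`φ` are weighted-homogeneous of degree `w i`. [folklore commutative algebra · OUR (o42) bookkeeping] -/
theorem eq_C_mul_pow_of_pow_dvd_of_le (w : σ → ℕ) (hw : ∀ j, 0 < w j) (i : σ) (hwi : ∀ j, w j ≤ w i) {ν : ℕ} (hν : 0 < ν)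
    {F G : MvPolynomial σ k} (hF : F.IsWeightedHomogeneous w (w i * ν)) (hFν : ∃ m ∈ F.support, Finsupp.degree m = ν)
    {d : ℕ} (hG : G.IsWeightedHomogeneous w d) (hd : 0 < d) (hdvd : G ^ ν ∣ F) :
    ∃ (c : k) (ℓ φ : MvPolynomial σ k), c ≠ 0 ∧ ℓ ≠ 0 ∧ F = C c * G ^ ν ∧ G = ℓ + φ ∧ ℓ.IsHomogeneous 1 ∧
      (∀ j, ℓ.coeff (Finsupp.single j 1) ≠ 0 → w j = w i) ∧ (∀ m ∈ φ.support, 2 ≤ Finsupp.degree m) ∧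
      ℓ.IsWeightedHomogeneous w (w i) ∧ φ.IsWeightedHomogeneous w (w i) ∧ d = w i := by
  classical
  obtain ⟨H, hFGH⟩ := hdvd
  obtain ⟨m₀, hm₀, hm₀deg⟩ := hFν
  have hF0 : F ≠ 0 := ne_zero_iff.mpr ⟨m₀, mem_support_iff.mp hm₀⟩
  have hG0 : G ≠ 0 := by rintro rfl; exact hF0 (by rw [hFGH, zero_pow hν.ne', zero_mul])
  have hH0 : H ≠ 0 := by rintro rfl; exact hF0 (by rw [hFGH, mul_zero])
  -- standard degree as the weight for `1`
  have hdeg1 : ∀ m : σ →₀ ℕ, Finsupp.weight (fun _ : σ => 1) m = Finsupp.degree m := fun m => by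
    rw [Finsupp.degree_eq_weight_one]
  -- (a) every monomial of `F` has standard degree `≥ ν`
  have hFge : ∀ m ∈ F.support, ν ≤ Finsupp.degree m := fun m hm => by
    have h1 : Finsupp.weight w m = w i * ν := hF (mem_support_iff.mp hm)
    have h2 := weight_le_mul_degree w i hwi m
    rw [h1] at h2
    exact Nat.le_of_mul_le_mul_left h2 (hw i)
  -- (b) lowest standard degrees of `G` and `H`
  obtain ⟨mG, hmG, hmGmin⟩ := Finset.exists_min_image G.support Finsupp.degree (support_nonempty.mpr hG0)
  obtain ⟨mH, hmH, hmHmin⟩ := Finset.exists_min_image H.support Finsupp.degree (support_nonempty.mpr hH0)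
  set aG := Finsupp.degree mG with haG
  set aH := Finsupp.degree mH with haH
  have hGlow : ∀ m ∈ G.support, aG ≤ Finsupp.weight (fun _ : σ => 1) m := fun m hm => by rw [hdeg1]; exact hmGmin m hm
  have hHlow : ∀ m ∈ H.support, aH ≤ Finsupp.weight (fun _ : σ => 1) m := fun m hm => by rw [hdeg1]; exact hmHmin m hm
  have hinG : weightedHomogeneousComponent (fun _ : σ => 1) aG G ≠ 0 := by
    have h := weightedHomogeneousComponent_ne_zero_of_mem_support (fun _ : σ => 1) hmG
    rwa [hdeg1] at h
  have hinH : weightedHomogeneousComponent (fun _ : σ => 1) aH H ≠ 0 := by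
    have h := weightedHomogeneousComponent_ne_zero_of_mem_support (fun _ : σ => 1) hmH
    rwa [hdeg1] at h
  have hbot : weightedHomogeneousComponent (fun _ : σ => 1) (ν * aG + aH) F ≠ 0 := by
    rw [hFGH, weightedHomogeneousComponent_mul_of_le_weight (fun _ : σ => 1) (le_weight_of_mem_support_pow (fun _ : σ => 1) hGlow ν)
      hHlow, weightedHomogeneousComponent_pow_of_le_weight (fun _ : σ => 1) hGlow ν]
    exact mul_ne_zero (pow_ne_zero _ hinG) hinH
  -- hence `ν · aG + aH = ν`
  have hsum : ν * aG + aH = ν := by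
    obtain ⟨m₁, hm₁, hm₁w⟩ := exists_mem_support_of_weightedHomogeneousComponent_ne_zero (fun _ : σ => 1) hbot
    rw [hdeg1] at hm₁w
    have h1 : ν ≤ ν * aG + aH := hm₁w ▸ hFge m₁ hm₁
    have h2 : ν * aG + aH ≤ ν := by
      have h3 := le_weight_of_mem_support_mul (fun _ : σ => 1) (le_weight_of_mem_support_pow (fun _ : σ => 1) hGlow ν) hHlow m₀
        (by rw [← hFGH]; exact hm₀)
      rwa [hdeg1, hm₀deg] at h3
    exact le_antisymm h2 h1
  -- `aG ≠ 0`: a constant term in `G` forces `d = 0`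
  have haG0 : aG ≠ 0 := by
    intro h0
    have hmG0 : mG = 0 := (Finsupp.degree_eq_zero_iff mG).mp (by rw [← haG, h0])
    rw [hmG0] at hmG
    have hd0 : Finsupp.weight w (0 : σ →₀ ℕ) = d := hG (mem_support_iff.mp hmG)
    rw [map_zero] at hd0
    exact hd.ne hd0
  have haG1 : aG = 1 := by
    have h1 : ν * aG ≤ ν * 1 := by rw [mul_one]; omega
    have h2 := Nat.le_of_mul_le_mul_left h1 hν
    omega
  have haH0 : aH = 0 := by rw [haG1, mul_one] at hsum; omega
  -- (c) `H = C h₀`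
  have hmH0 : mH = 0 := (Finsupp.degree_eq_zero_iff mH).mp (by rw [← haH, haH0])
  set h₀ := coeff 0 H with hh₀
  have hh₀0 : h₀ ≠ 0 := by rw [hh₀, ← hmH0]; exact mem_support_iff.mp hmH
  set H' := H - C h₀ with hH'
  have hH'low : ∀ m ∈ H'.support, 1 ≤ Finsupp.weight w m := fun m hm => by
    have hm0 : m ≠ 0 := by
      rintro rfl
      rw [mem_support_iff, hH', coeff_sub, coeff_C, if_pos rfl, hh₀, sub_self] at hm
      exact hm rfl
    exact weight_pos_of_ne_zero w hw hm0
  have hGpow : (G ^ ν).IsWeightedHomogeneous w (ν * d) := by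
    have h := hG.pow ν
    rwa [smul_eq_mul] at h
  have hGpowlow : ∀ m ∈ (G ^ ν).support, ν * d ≤ Finsupp.weight w m := fun m hm => (hGpow (mem_support_iff.mp hm)).ge
  have hGH'low : ∀ m ∈ (G ^ ν * H').support, ν * d + 1 ≤ Finsupp.weight w m := le_weight_of_mem_support_mul w hGpowlow hH'low
  have hFsplit : F = G ^ ν * C h₀ + G ^ ν * H' := by rw [hFGH, hH']; ring
  have hGC : (G ^ ν * C h₀).IsWeightedHomogeneous w (ν * d) := by
    have h := hGpow.mul (isWeightedHomogeneous_C w h₀)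
    rwa [add_zero] at h
  -- `ν · d = w i · ν`
  have hνd : ν * d = w i * ν := by
    by_contra hne
    have h1 : weightedHomogeneousComponent w (ν * d) F = 0 := hF.weightedHomogeneousComponent_ne (ν * d) hne
    rw [hFsplit, map_add, hGC.weightedHomogeneousComponent_same,
      weightedHomogeneousComponent_eq_zero' (ν * d) (G ^ ν * H') (fun m hm => by have := hGH'low m hm; omega), add_zero] at h1
    exact (mul_ne_zero (pow_ne_zero _ hG0) (C_eq_zero.not.mpr hh₀0)) h1
  have hdw : d = w i := by
    rw [mul_comm] at hνd
    exact Nat.eq_of_mul_eq_mul_right hν hνd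
  -- `G ^ ν · H′ = 0`
  have hGH'0 : G ^ ν * H' = 0 := by
    refine eq_zero_of_isWeightedHomogeneous_of_lt w (n := ν * d) ?_ (fun m hm => hGH'low m hm)
    have h1 : G ^ ν * H' = F - G ^ ν * C h₀ := by rw [hFsplit]; ring
    rw [h1, ← mem_weightedHomogeneousSubmodule]
    refine Submodule.sub_mem _ ?_ ?_
    · rw [mem_weightedHomogeneousSubmodule, hνd]; exact hF
    · rw [mem_weightedHomogeneousSubmodule]; exact hGC
  have hH'0 : H' = 0 := (mul_eq_zero.mp hGH'0).resolve_left (pow_ne_zero _ hG0)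
  have hHC : H = C h₀ := by rw [← sub_eq_zero, ← hH', hH'0]
  have hFe : F = C h₀ * G ^ ν := by rw [hFGH, hHC, mul_comm]
  -- (d) the structure of `G`
  set ℓ := weightedHomogeneousComponent (fun _ : σ => 1) 1 G with hℓ
  set φ := G - ℓ with hφ
  have hℓ0 : ℓ ≠ 0 := by
    have h := hinG
    rw [haG1] at h
    rw [hℓ]
    exact h
  have hGe : G = ℓ + φ := by rw [hφ]; ring
  have hℓhom : ℓ.IsHomogeneous 1 := weightedHomogeneousComponent_isWeightedHomogeneous (w := fun _ : σ => 1) 1 G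
  have hℓcoeff : ∀ m, coeff m ℓ = if Finsupp.degree m = 1 then coeff m G else 0 := fun m => by
    rw [hℓ, coeff_weightedHomogeneousComponent, hdeg1]
  have hℓsupp : ∀ m ∈ ℓ.support, m ∈ G.support := fun m hm => by
    rw [mem_support_iff, hℓcoeff] at hm
    by_cases h1 : Finsupp.degree m = 1
    · rw [if_pos h1] at hm; exact mem_support_iff.mpr hm
    · exact absurd (if_neg h1) hm
  have hℓw : ℓ.IsWeightedHomogeneous w (w i) := fun m hm => by
    rw [← hdw]; exact hG (mem_support_iff.mp (hℓsupp m (mem_support_iff.mpr hm)))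
  have hφw : φ.IsWeightedHomogeneous w (w i) := by
    rw [hφ, ← mem_weightedHomogeneousSubmodule]
    refine Submodule.sub_mem _ ?_ ?_
    · rw [mem_weightedHomogeneousSubmodule, ← hdw]; exact hG
    · rw [mem_weightedHomogeneousSubmodule]; exact hℓw
  have hφdeg : ∀ m ∈ φ.support, 2 ≤ Finsupp.degree m := fun m hm => by
    rw [mem_support_iff, hφ, coeff_sub, hℓcoeff] at hm
    by_cases h1 : Finsupp.degree m = 1
    · rw [if_pos h1, sub_self] at hm; exact absurd rfl hm
    · rw [if_neg h1, sub_zero] at hm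
      have h2 : 1 ≤ Finsupp.degree m := haG1 ▸ hmGmin m (mem_support_iff.mpr hm)
      omega
  have hℓvar : ∀ j, ℓ.coeff (Finsupp.single j 1) ≠ 0 → w j = w i := fun j hj => by
    have h1 : Finsupp.weight w (Finsupp.single j 1) = w i := hℓw hj
    rwa [Finsupp.weight_single, one_smul] at h1
  exact ⟨h₀, ℓ, φ, hh₀0, hℓ0, hFe, hGe, hℓhom, hℓvar, hφdeg, hℓw, hφw, hdw⟩

/-- **(iso-succ) PART A′ in the orientation of `PointDropOf` / `P3bDropOf`**: `w = ![q, r₂, r₁]` with `0 < q ≤ r₂ ≤ r₁` (so `r₁` is a top weight,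
possibly `= r₂`), `i = 2`; `F` (the weighted initial form) weighted-homogeneous of degree `r₁ · ν` with a monomial of standard degree `ν`
((BR3) `exists_coeff_faceSum_ne_zero_of_degree_eq_fin3`, p536107); `G` weighted-homogeneous of positive degree with `G ^ ν ∣ F`.  Then
`F = C c * G ^ ν`, the degree of `G` is `r₁`, and `G = ℓ + φ` with `ℓ ≠ 0` a linear form in the variables of weight `r₁` and `φ` of standard
order `≥ 2`, both of weight `r₁`. [folklore commutative algebra · OUR (o42) bookkeeping] -/
theorem eq_C_mul_pow_of_pow_dvd_of_le_fin3 {q r₂ r₁ ν : ℕ} (hq : 0 < q) (hq₂ : q ≤ r₂) (h₂₁ : r₂ ≤ r₁) (hν : 0 < ν)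
    {F G : MvPolynomial (Fin 3) k} (hF : F.IsWeightedHomogeneous ![q, r₂, r₁] (r₁ * ν))
    (hFν : ∃ m ∈ F.support, Finsupp.degree m = ν) {d : ℕ} (hG : G.IsWeightedHomogeneous ![q, r₂, r₁] d) (hd : 0 < d)
    (hdvd : G ^ ν ∣ F) :
    ∃ (c : k) (ℓ φ : MvPolynomial (Fin 3) k), c ≠ 0 ∧ ℓ ≠ 0 ∧ F = C c * G ^ ν ∧ G = ℓ + φ ∧ ℓ.IsHomogeneous 1 ∧
      (∀ j, ℓ.coeff (Finsupp.single j 1) ≠ 0 → (![q, r₂, r₁] : Fin 3 → ℕ) j = r₁) ∧ (∀ m ∈ φ.support, 2 ≤ Finsupp.degree m) ∧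
      ℓ.IsWeightedHomogeneous ![q, r₂, r₁] r₁ ∧ φ.IsWeightedHomogeneous ![q, r₂, r₁] r₁ ∧ d = r₁ := by
  have hw : ∀ j : Fin 3, 0 < (![q, r₂, r₁] : Fin 3 → ℕ) j := by
    intro j
    fin_cases j
    · exact hq
    · exact lt_of_lt_of_le hq hq₂
    · exact lt_of_lt_of_le hq (hq₂.trans h₂₁)
  have hwi : ∀ j : Fin 3, (![q, r₂, r₁] : Fin 3 → ℕ) j ≤ (![q, r₂, r₁] : Fin 3 → ℕ) 2 := by
    intro j
    fin_cases j
    · exact hq₂.trans h₂₁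
    · exact h₂₁
    · exact le_rfl
  exact eq_C_mul_pow_of_pow_dvd_of_le (k := k) ![q, r₂, r₁] hw 2 hwi hν (F := F) (G := G) hF hFν hG hd hdvd

end PartAPrime

end Iota3

end Summit.ResolutionOfSingularities.ResolutionOfSingularities.Cruxes.HypersurfaceCentreConstruction.LocalEngine
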